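import Summits.BirchSwinnertonDyer.BirchSwinnertonDyer.Theorems.AdditiveBranchIMCGordTwoRankOneTwistOddRowClosedHL
import Summits.BirchSwinnertonDyer.BirchSwinnertonDyer.Theorems.AdditiveBranchIMCGordTwoRankZeroOffCaseOneTwistRowTameClosed
import Summits.BirchSwinnertonDyer.BirchSwinnertonDyer.Theorems.AdditiveBranchIMCTwistRootNumberAnyTwo
import HarnessLib

/-!
# Line `wan_tame_bdp_road` (crux `GordTwoRankOne`, stmt-BirchSwinnertonDyer-19358) — THE RANK-ONE TAME SUB-ROW WITHOUT THE «SEMISTABLE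
# OUTSIDE `p`» CLAUSE, DYADIC FORM: every additive prime — `2` included — of quadratic-twist type, from the SAME ten printed theorems
# (LEAD cruxlead-19357 g14, for the pen)

Dyadic form of `AdditiveBranchIMCGordTwoRankOneTwistOddRowClosedHL.lean` (p755932, LEAD g13: no additive reduction above `2`, odd additive primes
of twist type). The two places where that file read the clause at `2` are now free of it: F5 goes through LEAD g14's engine
`TwistRootNumberAnyTwo.rootNumber_quadraticTwist_mul_eq_of_nonsplit_odd_anyTwo` (p758548, NO hypothesis at `2`), and the ♭-inclusion through
`TwistRowClosed.flatInclusion_twistAny` (dyadic partner p759039 + the dyadic semistable-twist reading of Castella–Liu–Wan, p758711; `2` splits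
in the tame-road field). Hence, with «IF `E` is additive at `2` THEN `E^{(t)}` is not additive at `2` for some `t ∈ {−1, 2, −2}`» (`h2tt`):

* `exists_ramifiedAt_splitAt_twist_ne_zero_twistAny` — F5 with one RAMIFIED Wan prime, NO hypothesis at `2` (Hoffstein–Luo + modularity);
* `exists_fieldOne_gordTwo_rankOne_twistAny` — the rank-one field supply (no hypothesis at `2`);
* `missingLowerBoundAt_rankOne_of_twistAny_tenFacts` — for `r_an(E) = 1`, `N10.CellGordTwo W p`, `p ≥ 5`, `ρ̄` onto, EVERY additive prime of
  quadratic-twist type (`h2tt`, `htt`), a Wan prime: `MissingLowerBoundAt W p` GIVEN the SAME ten printed theorems as p746425 / p755932 (the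
  Castella–Liu–Wan pair in the DYADIC semistable-twist reading; `d ≡ 1 (mod 4)` gives back p752321's pair). For the pen's next mirror of
  `Lines/wan_tame_bdp_road.lean` (`PrintedFactsTame` := these ten, in this order; sub-row widened by the additive `2` of twist type).

THEOREMS ONLY; no definition, no named fact, no `sorry`; crux 19358 stays OPEN; BSD is proved for no curve by any of this.
References: [HoffsteinLuo1997] Theorem (§1); [FriedbergHoffstein1995] Thm. B; [JetchevSkinnerWan2017] §7.4.1; [CastellaLiuWan2022] Thm. 8.2.1 (p. 85);
[Kato2004Asterisque] Thm. 17.4; [Delbourgo1998] Prop. 4; [AtkinLi1978] §1, §3.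
-/

set_option linter.dupNamespace false
set_option autoImplicit false

noncomputable section

open scoped Classical

open NumberField IsDedekindDomain IsDedekindDomain.HeightOneSpectrum Rat.HeightOneSpectrum
open WeierstrassCurve Literature.NumberTheory.EllipticCurves
  Literature.NumberTheory.EllipticCurves.ModularForms
  Literature.NumberTheory.EllipticCurves.Rank1Residual
  Literature.NumberTheory.EllipticCurves.Rank1Residual.Typed

open Summit.BirchSwinnertonDyer.Rank1Residual
open Summit.BirchSwinnertonDyer.Rank1Residual.Additive
open Summit.BirchSwinnertonDyer.BirchSwinnertonDyer.Theorems
open Field Literature.NumberTheory.EllipticCurves.ModularForms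
open ThreeFieldRoadSupply

namespace Summit.BirchSwinnertonDyer.BirchSwinnertonDyer.Theorems.TwistRowRankOneClosedHL

/-! ### §0 F5 on the row — no hypothesis at `2` -/

/-- **F5 (`friedbergHoffstein_exists_twist_ne_zero_ramifiedAt_splitAt`) for curves with odd additive primes of quadratic-twist type and ANY reduction at `2`, EVERY odd non-split multiplicative prime `q`**,
from the Modularity Theorem and Hoffstein–Luo 1997 through LEAD g14's engine `TwistRootNumberAnyTwo` (verbatim p755932's §0 otherwise).
[cite: FriedbergHoffstein1995, Thm. B] [cite: HoffsteinLuo1997, Theorem (§1, pp. 435–436)] -/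
theorem exists_ramifiedAt_splitAt_twist_ne_zero_twistAny (W : WeierstrassCurve ℚ) [W.IsElliptic] [W.IsGloballyMinimal]
    (hmod : exists_isNewformOf)
    (hHL : HoffsteinLuo1997_exists_twist_L_one_ne_zero)
    (htt : ∀ p : Nat.Primes, (p : ℕ) ≠ 2 → W.HasAdditiveReductionAt ((primesEquiv (R := ℤ)).symm p) →
      ¬ (W.quadraticTwist (((-1 : ℤ) ^ ((p : ℕ) / 2) * p : ℤ) : ℚ)).HasAdditiveReductionAt
        ((primesEquiv (R := ℤ)).symm p))
    (hw : W.rootNumber = -1) (q : ℕ) [hq : Fact q.Prime] (hq2 : q ≠ 2)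
    (hqm : W.HasMultiplicativeReductionAtPrime q) (hqns : ¬ W.HasSplitMultiplicativeReductionAtPrime q)
    (p : ℕ) (hp : p.Prime) (hpq : p ≠ q) (B : ℕ) :
    ∃ (K : Type) (_ : Field K) (_ : NumberField K),
      IsImaginaryQuadratic K ∧ B < (NumberField.discr K).natAbs ∧ (q : ℤ) ∣ NumberField.discr K ∧
        (∀ ℓ : ℕ, ℓ.Prime → ℓ ∣ W.conductorNorm ℤ → ℓ ≠ q →
          ((Ideal.span {(ℓ : ℤ)}).primesOver (𝓞 K)).ncard = 2) ∧
        (¬ 2 ∣ W.conductorNorm ℤ → ((Ideal.span {(2 : ℤ)}).primesOver (𝓞 K)).ncard = 2) ∧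
        SatisfiesHeegnerHypothesis p K ∧
          (W.quadraticTwist (NumberField.discr K : ℚ)).entireLFunction 1 ≠ 0 :=
  exists_ramifiedAt_splitAt_twist_ne_zero_of_rootNumber_twist W hmod hHL hw q hq2
    (fun ℓ hℓ hℓ5 hqℓ hℓg h8 hjac ↦ by
      haveI := Fact.mk hℓ
      exact TwistRootNumberAnyTwo.rootNumber_quadraticTwist_mul_eq_of_nonsplit_odd_anyTwo W hmod htt hq2 hℓ5 (by omega)
        hqm hqns hℓg h8 hjac)
    p hp hpq B

section FieldOne

variable (W : WeierstrassCurve ℚ) [W.IsElliptic] [W.IsGloballyMinimal] (p : ℕ) [hp : Fact p.Prime]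

/-- **FIELD SUPPLY of the rank-one tame road, odd additive primes of twist type, ANY `2`** — the statement of `TameRoadRowRankOneClosedHL.exists_fieldOne_gordTwo_rankOne_of_hoffsteinLuo` with
«semistable outside `p`» replaced by the engine's hypothesis `htt` (the
tame-road field `K` with the Wan prime ramified and `L(E^{(d_K)}, 1) ≠ 0`, a globally minimal rank-zero twist `Wd` on the same cell with `ρ̄`
onto), from Hoffstein–Luo 1997 and the Modularity Theorem (`exists_isNewformOf`) instead of Friedberg–Hoffstein's ramified F5, valid for EVERY Wan
prime (F5 `exists_ramifiedAt_splitAt_twist_ne_zero_twistAny`, over LEAD g14's engine `TwistRootNumberAnyTwo`).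
[cite: HoffsteinLuo1997, Theorem (§1, pp. 435–436)] [cite: Castella2018, §5 (arXiv:1704.06608 p. 12)] [cite: SilvermanAEC2009, X.5 Cor. 5.4 and Thm VII.6.1] -/
theorem exists_fieldOne_gordTwo_rankOne_twistAny (hnf : exists_isNewformOf)
    (hHL : HoffsteinLuo1997_exists_twist_L_one_ne_zero)
    (hpar : ∀ X : WeierstrassCurve ℚ, even_analyticRank_iff_rootNumber_eq_one X)
    (hmod : hasEntireLFunction_rat)
    (hp5 : 5 ≤ p) (hr : W.analyticRank = 1) (hcell : N10.CellGordTwo W p) (hsurj : Surj W p)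
    (htt : ∀ r : Nat.Primes, (r : ℕ) ≠ 2 → W.HasAdditiveReductionAt ((primesEquiv (R := ℤ)).symm r) →
      ¬ (W.quadraticTwist (((-1 : ℤ) ^ ((r : ℕ) / 2) * r : ℤ) : ℚ)).HasAdditiveReductionAt
        ((primesEquiv (R := ℤ)).symm r))
    {q : ℕ} [Fact q.Prime] (hqp : q ≠ p) (hq2 : q ≠ 2)
    (hqm : W.HasMultiplicativeReductionAtPrime q) (hqns : ¬ W.HasSplitMultiplicativeReductionAtPrime q) :
    ∃ (K : Type) (_ : Field K) (_ : NumberField K)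
      (Wd : WeierstrassCurve ℚ) (_ : Wd.IsElliptic) (_ : Wd.IsGloballyMinimal),
      IsImaginaryQuadratic K ∧ (q : ℤ) ∣ NumberField.discr K ∧
        (∀ ℓ : ℕ, ℓ.Prime → ℓ ∣ W.conductorNorm ℤ → ℓ ≠ q →
          ((Ideal.span {(ℓ : ℤ)}).primesOver (𝓞 K)).ncard = 2) ∧
        (¬ 2 ∣ W.conductorNorm ℤ → ((Ideal.span {(2 : ℤ)}).primesOver (𝓞 K)).ncard = 2) ∧
        SatisfiesHeegnerHypothesis p K ∧
        ((Ideal.span {(2 : ℤ)}).primesOver (𝓞 K)).ncard = 2 ∧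
        (∃ C : VariableChange ℚ, C • W.quadraticTwist (NumberField.discr K : ℚ) = Wd) ∧
        (W.quadraticTwist (NumberField.discr K : ℚ)).entireLFunction 1 ≠ 0 ∧
        Wd.analyticRank = 0 ∧ N10.CellGordTwo Wd p ∧ Surj Wd p := by
  have hw : W.rootNumber = -1 := (rootNumber_of_analyticRank_le_one W hpar).2 hr
  obtain ⟨K, iF, iN, hK, -, hqd, hsplit, h2s, hpK, hL⟩ :=
    exists_ramifiedAt_splitAt_twist_ne_zero_twistAny W hnf hHL htt hw q hq2 hqm hqns p hp.out hqp.symm 0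
  have h2K : ((Ideal.span {(2 : ℤ)}).primesOver (𝓞 K)).ncard = 2 := by
    by_cases h2N : 2 ∣ W.conductorNorm ℤ
    · exact hsplit 2 Nat.prime_two h2N (Ne.symm hq2)
    · exact h2s h2N
  have hD0 : (NumberField.discr K : ℚ) ≠ 0 := by exact_mod_cast NumberField.discr_ne_zero K
  obtain ⟨Wd, iWd, iWdm, Cd', hCd'⟩ := exists_isGloballyMinimal_smul_eq_quadraticTwist W hD0
  have hWd : Cd'⁻¹ • W.quadraticTwist (NumberField.discr K : ℚ) = Wd := by rw [← hCd', inv_smul_smul]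
  refine ⟨K, iF, iN, Wd, iWd, iWdm, hK, hqd, hsplit, h2s, hpK, h2K, ⟨Cd'⁻¹, hWd⟩, hL, ?_, ?_, ?_⟩
  · exact analyticRank_eq_zero_tameTwist W K hmod Cd'⁻¹ hWd hL
  · exact cellGordTwo_tameTwist W p K hp5 hK hpK h2K Cd'⁻¹ hWd hcell
  · exact surj_tameTwist W p K Cd'⁻¹ hWd hsurj

end FieldOne

/-- **THE DYADIC TWIST-TYPE SUB-ROW IN ANALYTIC RANK ONE FROM THE TEN PRINTED THEOREMS** (`p ≥ 5`, `ρ̄` onto, EVERY additive prime — `2`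
included — of quadratic-twist type, a Wan prime; the Castella–Liu–Wan pair in the DYADIC semistable-twist reading) — the statement of
`TameRoadRowRankOneClosedHL.missingLowerBoundAt_rankOne_of_tameRoadRow_tenFacts` re-keyed: the TEN hypotheses are skeleton v18's
`PrintedFactsTame` minus F5 — Kato/Wuthrich's cyclotomic half at a surjective prime, Delbourgo 1998 Prop. 4, GZK, a modular parametrisation,
Hoffstein–Luo 1997, Cai–Shu–Tian 2014 Thm 1.1 (ring class character), Hsieh 2014 Thm B, Liu–Zhang–Zhang 2018, Castella–Liu–Wan 2022 Thm. 8.2.1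
and §6.1. Derived in the tree: the entire continuation and parity (modularity), Gross–Zagier I.(7.3) over `ℚ`
(`ExplicitGrossZagierTrivialChar.GrossZagier1986_thm_I_7_3_of_thm11_ringClassChar`), Cai–Shu–Tian for the trivial character
(`…thm11_trivialChar_of_thm11_ringClassChar`), and F5 (§1). Proof = p746425's / p755932's chain verbatim with the field supply of §1 and the ♭-inclusion
`TwistRowClosed.flatInclusion_twistAny` (LEAD g14).
[cite: JetchevSkinnerWan2017, §7.4.1 (arXiv:1512.06894 p. 30)] [cite: CastellaLiuWan2022, Thm. 8.2.1 (1)] [cite: Kato2004Asterisque, Thm. 17.4]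
[cite: Delbourgo1998, Prop. 4] [cite: HoffsteinLuo1997, Theorem (§1, pp. 435–436)] -/
theorem missingLowerBoundAt_rankOne_of_twistAny_tenFacts
    (hWu : Wuthrich2014.kato_halfEigenCharIdeal_dvd_cyclotomicPrime_of_surjective)
    (hDel : Delbourgo1998.prop4_rankZero_pow_dvd_constantCoeff)
    (hGZK : rank_eq_analyticRank_of_analyticRank_le_one) (hmodP : nonempty_modularParametrizationData)
    (hHL : HoffsteinLuo1997_exists_twist_L_one_ne_zero) (hCSTrc : CaiShuTian2014.thm11_ringClassChar)
    (hB : Hsieh2014.thmB_exists_isHsiehLFunction_coeff_norm_eq_one_unrPeriod_ramifiedSteinberg)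
    (hLZZ : LiuZhangZhang2018.thm151_thm153_modularCurve_heegnerVector_additive_ramifiedSteinberg)
    (h821 : CastellaLiuWan2022.thm821_XGr₂_charIdeal_mul_le_awayFromCyc_semistableTwistDyadic)
    (h61 : CastellaLiuWan2022.sec61_exists_isCastellaLiuWanLFunction₂_semistableTwistDyadic)
    (W : WeierstrassCurve ℚ) [W.IsElliptic] [W.IsGloballyMinimal] (p : ℕ) [Fact p.Prime]
    (hr : W.analyticRank = 1) (hcell : N10.CellGordTwo W p) (hp5 : 5 ≤ p) (hsurj : Surj W p)
    (h2tt : ∀ r : Nat.Primes, (r : ℕ) = 2 → W.HasAdditiveReductionAt ((primesEquiv (R := ℤ)).symm r) →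
      ∃ t : ℤ, (t = -1 ∨ t = 2 ∨ t = -2) ∧ ¬ (W.quadraticTwist (t : ℚ)).HasAdditiveReductionAt ((primesEquiv (R := ℤ)).symm r))
    (htt : ∀ r : Nat.Primes, (r : ℕ) ≠ 2 → W.HasAdditiveReductionAt ((primesEquiv (R := ℤ)).symm r) →
      ¬ (W.quadraticTwist (((-1 : ℤ) ^ ((r : ℕ) / 2) * r : ℤ) : ℚ)).HasAdditiveReductionAt
        ((primesEquiv (R := ℤ)).symm r))
    {q : ℕ} [hqF : Fact q.Prime] (hWan : WanPrime W p q) :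
    MissingLowerBoundAt W p := by
  -- the derived facts
  have hnf : exists_isNewformOf := exists_isNewformOf_of_nonempty_modularParametrizationData hmodP
  have hmod : hasEntireLFunction_rat := WeierstrassCurve.hasEntireLFunction_rat_of_exists_isNewformOf hnf
  have hpar : ∀ X : WeierstrassCurve ℚ, even_analyticRank_iff_rootNumber_eq_one X :=
    fun X ↦ even_analyticRank_iff_rootNumber_eq_one_of_exists_isNewformOf X hnf
  have hGZ73 : GrossZagier1986_thm_I_7_3 :=
    ExplicitGrossZagierTrivialChar.GrossZagier1986_thm_I_7_3_of_thm11_ringClassChar hmodP hHL hCSTrc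
  have hCST : CaiShuTian2014.thm11_trivialChar :=
    ExplicitGrossZagierTrivialChar.thm11_trivialChar_of_thm11_ringClassChar hCSTrc hmod
  obtain ⟨hqp, hq2, hqm, hqns, hqv⟩ := hWan
  -- the supply: the tame-road field `K` and the rank-zero twist `Wd` (from Hoffstein–Luo)
  obtain ⟨K, iF, iN, Wd, iWd, iWdm, hK, hqd, hsplit, h2s, hpK, -, htw, -, hrd, hcelld, hsurjd⟩ :=
    exists_fieldOne_gordTwo_rankOne_twistAny W p hnf hHL hpar hmod hp5 hr hcell hsurj htt hqp hq2 hqm hqns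
  have hTRF : TameRoadField W p K := ⟨hK, ⟨q, hqF, ⟨hqp, hq2, hqm, hqns, hqv⟩, hqd, hsplit⟩, h2s, hpK⟩
  have hsum : W.analyticRank + Wd.analyticRank = 1 := by omega
  -- the tame road: ♭-inclusion ⟹ branch socket ⟹ Step L ⟹ joint lower half
  have hIncl := TwistRowClosed.flatInclusion_twistAny hmodP hB h821 h61 W p K hcell hp5 hsurj h2tt htt hTRF
  have hsock := TameBranchSocket.branchSocketAt_of_flatInclusionUnit_rankFree hB hLZZ hCST hGZK hmod W p K hp5 hcell.2.1 hsurj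
    hTRF hIncl
  have hstepL := TameJointLower.tameStepLAt_of_branchSocketAt hCST hGZK hmod W p K Wd hp5 hcell.2.1 hTRF htw hsum hsock
  have hJ : JointLowerBoundAt W Wd p :=
    TameJointLower.jointLowerBoundAt_of_tameRoadField_of_stepL hCST hGZK hmod hmodP hGZ73 W p K Wd hp5 hTRF htw hsum hstepL
  -- the twist's upper half from the tree (rank `0`, `ρ̄` onto, `p ≥ 5`)
  have hX4 : ClassX4Gord Wd p :=
    ⟨⟨hcelld.1, hcelld.2.1, hasIrreducibleModPGaloisRep_of_hasSurjectiveModNGaloisRep Wd p hsurjd⟩, hcelld.2.2.1⟩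
  have hed : semistabilityIndex Wd p = 2 := hcelld.2.2.2
  have hram3 : p = 3 → Ram Wd p := fun h3 ↦ absurd h3 (by omega)
  exact missingLowerBoundAt_of_joint_of_upper hJ
    (ClassX4Gord.missingUpperBoundAt_rankZero_of_katoHalf hWu hDel hGZK hmod hmodP hX4 hed hrd hsurjd hram3)

end Summit.BirchSwinnertonDyer.BirchSwinnertonDyer.Theorems.TwistRowRankOneClosedHL

end
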